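import Summits.HodgeConjecture.HodgeConjecture.Theorems.Ring2WeilCoverageCMFieldNormResidueSymbolsPlaces
import Literature.NumberTheory.QuadraticForms.HilbertSymbolUnramified
import Mathlib.NumberTheory.RamificationInertia.Valuation
import HarnessLib

/-!
# Ring 2 — Weil-family coverage, CM-field rows: the CLOSED FORM of the local symbol `(q, θ)_v` at the places
  `v ∤ 2θ` — INERT: valuation parity, SPLIT: `+1` — and the integer rows `[ℓw]` at an inert unramified place
  (WEIL-FAMILY-COVERAGE «## b03», open cell (ix′), part 3)

research route conditional on HC_CM; not a corollary; Q11.4-sentence-2 already refuted in dim ≥ 3.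

Sequel of `Ring2WeilCoverageCMFieldNormResidueSymbols` / `…Places`: there the row index `[q] ∈ F^×/Nm_{E/F}(E^×)`
of Deligne's carriers (`F = ℚ[S]/(R) = ℚ(θ) ⊂ E = F(√θ)`) [cite: Deligne1982HodgeCycles, §4: display (1), Prop. 4.1
and Cor. 4.2 — p. 28 of the re-edition of LNM 900] was identified with the finite even set `T(q)` of places `v`
with `(q, θ)_v = -1`.  Here the census's recipe for COMPUTING `T(q)` (§b03.5: «the inert part of `T(δ)` is
`{v inert : ord_v δ odd}`», §b03.19 (ix′)) becomes a kernel theorem at every finite place `v ∤ 2θ` of `F`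
(`R` monic, so that `θ ∈ 𝓞_F`), from the tree's O'Meara 63:11a/63:12
(`hilbertSymbol_eq_neg_one_iff_not_isSquare_and_odd`, `HilbertSymbolUnramified`):

* §6 `θ ∈ 𝓞_F` (`exists_ringOfIntegers_coe_eq_root`).
* §7 `hilbertSymbol_adicCompletion_root_eq_neg_one_iff`: for `v ∤ 2`, `θ ∉ v`, `t ∈ F^×`:
  `(t, θ)_v = -1 ⟺ (θ mod v is a non-square) ∧ ord_v t odd`; so at an INERT place (`θ` non-square mod `v`)
  `v ∈ T(t) ⟺ ord_v t` odd, and at a SPLIT place (`θ` square mod `v`) `v ∉ T(t)`.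
* §8 consequences for the rows: the parity of `ord_v` at an inert `v ∤ 2θ` is a CLASS INVARIANT
  (`odd_log_valuation_iff_of_mk_eq_mk`), and a class with `ord_v q` odd there is NOT the split class
  (`mk_ne_splitDiscriminantClassCM_of_odd_log_valuation`) — the uniform form of the prime-by-prime descents of
  `Ring2WeilCoverageCMFieldInertPrimes` / `…AllPrimes*`.
* §9 `mk_natCast_mul_ne_splitDiscriminantClassCM_of_inert`: for a rational prime `ℓ` and a place `v | ℓ` of `F`
  UNRAMIFIED over `ℓ`, inert in `E` and prime to `2θ`, and `ℓ ∤ w`: `ord_v(ℓw) = 1`, so `[ℓw] ≠ [(-1)^k]` — the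
  integer rows `W_{2k}.E.[ℓ]` of §b03.5 at inert `ℓ`, for EVERY carrier at once (Mathlib `intValuation_liesOver`).
No new definition, no named fact, no sorry.
-/

noncomputable section

set_option linter.dupNamespace false

open Polynomial NumberField IsDedekindDomain

namespace Summit.HodgeConjecture.HodgeConjecture.Ring2.WeilCoverageCM

open Literature.AlgebraicGeometry.Deligne1982
open Literature.AlgebraicGeometry.HodgeTheory (splitDiscriminantClassCM)
open Literature.NumberTheory.QuadraticForms

variable {R : Polynomial ℤ} [Fact (Irreducible (cmPolyQ R))] [Fact (Irreducible (realPolyQ R))]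

/-! ### §6 `θ` is an algebraic integer -/

omit [Fact (Irreducible (cmPolyQ R))] in
/-- For `R` monic, `θ` (a root of `R ∈ ℤ[S]`) is an algebraic integer of `F`. [cite: Deligne1982HodgeCycles, §4 p. 30] -/
theorem isIntegral_root_realPolyQ (hRm : R.Monic) : IsIntegral ℤ (AdjoinRoot.root (realPolyQ R)) := by
  refine ⟨R, hRm, ?_⟩
  have h0 := AdjoinRoot.eval₂_root (realPolyQ R)
  rw [Polynomial.eval₂_map] at h0
  rwa [show (AdjoinRoot.of (realPolyQ R)).comp (Int.castRingHom ℚ) = algebraMap ℤ (realField R) from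
    RingHom.ext_int _ _] at h0

omit [Fact (Irreducible (cmPolyQ R))] in
/-- `θ ∈ 𝓞_F`: some `θₒ : 𝓞 F` has `(θₒ : F) = θ` (`R` monic). [cite: Deligne1982HodgeCycles, §4 p. 30] -/
theorem exists_ringOfIntegers_coe_eq_root (hRm : R.Monic) :
    ∃ θₒ : 𝓞 (realField R), (θₒ : realField R) = AdjoinRoot.root (realPolyQ R) :=
  ⟨⟨AdjoinRoot.root (realPolyQ R), isIntegral_root_realPolyQ hRm⟩, rfl⟩

/-! ### §7 The local symbol at `v ∤ 2θ`: inert ⟹ valuation parity, split ⟹ `+1` (O'Meara 63:11a, 63:12) -/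

omit [Fact (Irreducible (cmPolyQ R))] in
/-- **CLOSED FORM of `(t, θ)_v` at a finite place `v ∤ 2θ` of `F`**: `(t, θ)_v = -1` iff `θ` is a NON-SQUARE
modulo `v` (i.e. `v` is INERT in `E = F(√θ)`) AND `ord_v t` is ODD (O'Meara 63:11a / Example 63:12: against a
`v`-unit the symbol is the Legendre symbol of the unit to the power `ord_v t`; Hensel: `θ ∈ F_v²` iff `θ` is a
square mod `v`). [cite: Omeara1963, §63B Cor. 63:11a and Example 63:12] -/
theorem hilbertSymbol_adicCompletion_root_eq_neg_one_iff {θₒ : 𝓞 (realField R)}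
    (hθ : (θₒ : realField R) = AdjoinRoot.root (realPolyQ R)) (v : HeightOneSpectrum (𝓞 (realField R)))
    (h2 : (2 : 𝓞 (realField R)) ∉ v.asIdeal) (hθv : θₒ ∉ v.asIdeal) {t : realField R} (ht : t ≠ 0) :
    hilbertSymbol (v.adicCompletion (realField R)) (algebraMap (realField R) _ t)
        (algebraMap (realField R) _ (AdjoinRoot.root (realPolyQ R))) = -1 ↔
      ¬ IsSquare (Ideal.Quotient.mk v.asIdeal θₒ) ∧ Odd (WithZero.log (v.valuation (realField R) t)) := by
  have hθ' : algebraMap (realField R) (v.adicCompletion (realField R)) (AdjoinRoot.root (realPolyQ R)) =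
      algebraMap (𝓞 (realField R)) (v.adicCompletion (realField R)) θₒ := by
    rw [IsScalarTower.algebraMap_apply (𝓞 (realField R)) (realField R) (v.adicCompletion (realField R)), ← hθ]
  rw [hθ', hilbertSymbol_eq_neg_one_iff_not_isSquare_and_odd (realField R) v h2 hθv
      ((_root_.map_ne_zero _).2 ht)]
  have e1 : IsSquare (algebraMap (𝓞 (realField R)) (v.adicCompletion (realField R)) θₒ) ↔
      IsSquare (Ideal.Quotient.mk v.asIdeal θₒ) :=
    isSquare_algebraMap_adicCompletion_iff (realField R) v h2 hθv
  have e2 : Valued.v (algebraMap (realField R) (v.adicCompletion (realField R)) t) =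
      v.valuation (realField R) t :=
    HeightOneSpectrum.valuedAdicCompletion_eq_valuation' v t
  rw [e2]
  exact and_congr (not_congr e1) Iff.rfl

omit [Fact (Irreducible (cmPolyQ R))] in
/-- **INERT places: `(t, θ)_v = -1 ⟺ ord_v t` odd** (`v ∤ 2θ`, `θ` a non-square mod `v`) — «the inert part of
`T(δ)` is `{v inert : ord_v δ odd}`» (§b03.19 (ix′)). [cite: Omeara1963, §63B Example 63:12 and §63C Example 63:16] -/
theorem hilbertSymbol_adicCompletion_root_eq_neg_one_iff_odd {θₒ : 𝓞 (realField R)}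
    (hθ : (θₒ : realField R) = AdjoinRoot.root (realPolyQ R)) (v : HeightOneSpectrum (𝓞 (realField R)))
    (h2 : (2 : 𝓞 (realField R)) ∉ v.asIdeal) (hθv : θₒ ∉ v.asIdeal)
    (hns : ¬ IsSquare (Ideal.Quotient.mk v.asIdeal θₒ)) {t : realField R} (ht : t ≠ 0) :
    hilbertSymbol (v.adicCompletion (realField R)) (algebraMap (realField R) _ t)
        (algebraMap (realField R) _ (AdjoinRoot.root (realPolyQ R))) = -1 ↔
      Odd (WithZero.log (v.valuation (realField R) t)) := by
  rw [hilbertSymbol_adicCompletion_root_eq_neg_one_iff hθ v h2 hθv ht]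
  exact ⟨fun h ↦ h.2, fun h ↦ ⟨hns, h⟩⟩

omit [Fact (Irreducible (cmPolyQ R))] in
/-- **SPLIT places: `(t, θ)_v = 1`** for every `t` (`v ∤ 2θ`, `θ` a square mod `v`): a place of `F` split in `E`
lies in no `T(δ)`. [cite: Omeara1963, §63B Example 63:12] -/
theorem hilbertSymbol_adicCompletion_root_eq_one_of_isSquare_residue {θₒ : 𝓞 (realField R)}
    (hθ : (θₒ : realField R) = AdjoinRoot.root (realPolyQ R)) (v : HeightOneSpectrum (𝓞 (realField R)))
    (h2 : (2 : 𝓞 (realField R)) ∉ v.asIdeal) (hθv : θₒ ∉ v.asIdeal)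
    (hsq : IsSquare (Ideal.Quotient.mk v.asIdeal θₒ)) (t : realField R) :
    hilbertSymbol (v.adicCompletion (realField R)) (algebraMap (realField R) _ t)
        (algebraMap (realField R) _ (AdjoinRoot.root (realPolyQ R))) = 1 := by
  have hθ' : algebraMap (realField R) (v.adicCompletion (realField R)) (AdjoinRoot.root (realPolyQ R)) =
      algebraMap (𝓞 (realField R)) (v.adicCompletion (realField R)) θₒ := by
    rw [IsScalarTower.algebraMap_apply (𝓞 (realField R)) (realField R) (v.adicCompletion (realField R)), ← hθ]
  rw [hθ']
  exact hilbertSymbol_eq_one_of_isSquare_residue (realField R) v h2 hθv hsq _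

/-! ### §8 Consequences for the rows: valuation parity at inert places `v ∤ 2θ` -/

omit [Fact (Irreducible (cmPolyQ R))] in
/-- **Membership of an inert place `v ∤ 2θ` in `T(q)`**: `v ∈ T(q) ⟺ ord_v q` odd.
[cite: Omeara1963, §63B Example 63:12] [cite: Deligne1982HodgeCycles, §4 (1)] -/
theorem inl_mem_badPlaces_iff_odd_log_valuation {θₒ : 𝓞 (realField R)}
    (hθ : (θₒ : realField R) = AdjoinRoot.root (realPolyQ R)) (v : HeightOneSpectrum (𝓞 (realField R)))
    (h2 : (2 : 𝓞 (realField R)) ∉ v.asIdeal) (hθv : θₒ ∉ v.asIdeal)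
    (hns : ¬ IsSquare (Ideal.Quotient.mk v.asIdeal θₒ)) (q : (realField R)ˣ) :
    Sum.inl v ∈ badPlaces (q : realField R) (AdjoinRoot.root (realPolyQ R)) ↔
      Odd (WithZero.log (v.valuation (realField R) (q : realField R))) := by
  rw [mem_badPlaces_iff, placeSymbol_inl,
    hilbertSymbol_adicCompletion_root_eq_neg_one_iff_odd hθ v h2 hθv hns (Units.ne_zero _)]

omit [Fact (Irreducible (cmPolyQ R))] in
/-- A split place `v ∤ 2θ` lies in no `T(q)`. [cite: Omeara1963, §63B Example 63:12] -/
theorem inl_notMem_badPlaces_of_isSquare_residue {θₒ : 𝓞 (realField R)}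
    (hθ : (θₒ : realField R) = AdjoinRoot.root (realPolyQ R)) (v : HeightOneSpectrum (𝓞 (realField R)))
    (h2 : (2 : 𝓞 (realField R)) ∉ v.asIdeal) (hθv : θₒ ∉ v.asIdeal)
    (hsq : IsSquare (Ideal.Quotient.mk v.asIdeal θₒ)) (q : (realField R)ˣ) :
    Sum.inl v ∉ badPlaces (q : realField R) (AdjoinRoot.root (realPolyQ R)) := by
  rw [mem_badPlaces_iff, placeSymbol_inl,
    hilbertSymbol_adicCompletion_root_eq_one_of_isSquare_residue hθ v h2 hθv hsq]
  norm_num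

/-- **The parity of `ord_v` at an inert place `v ∤ 2θ` is an invariant of the class `[q] ∈ F^×/Nm_{E/F}(E^×)`**
(the local norm residue symbol there IS `(-1)^{ord_v}`). [cite: Deligne1982HodgeCycles, §4 (1) and Prop. 4.1]
[cite: Omeara1963, §63C Example 63:16] -/
theorem odd_log_valuation_iff_of_mk_eq_mk {θₒ : 𝓞 (realField R)}
    (hθ : (θₒ : realField R) = AdjoinRoot.root (realPolyQ R)) (v : HeightOneSpectrum (𝓞 (realField R)))
    (h2 : (2 : 𝓞 (realField R)) ∉ v.asIdeal) (hθv : θₒ ∉ v.asIdeal)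
    (hns : ¬ IsSquare (Ideal.Quotient.mk v.asIdeal θₒ)) {q q' : (realField R)ˣ}
    (h : (QuotientGroup.mk q : cmNormResidueGroup R) = QuotientGroup.mk q') :
    Odd (WithZero.log (v.valuation (realField R) (q : realField R))) ↔
      Odd (WithZero.log (v.valuation (realField R) (q' : realField R))) := by
  rw [← inl_mem_badPlaces_iff_odd_log_valuation hθ v h2 hθv hns,
    ← inl_mem_badPlaces_iff_odd_log_valuation hθ v h2 hθv hns, (mk_eq_mk_iff_badPlaces_eq q q').1 h]

/-- **Distinct rows by valuation parity**: if `ord_v q` is odd and `ord_v q'` is even at some inert place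
`v ∤ 2θ`, then `[q] ≠ [q']`. [cite: Deligne1982HodgeCycles, §4 (1) and Prop. 4.1] [cite: Omeara1963, §63C Example 63:16] -/
theorem mk_ne_mk_of_odd_log_valuation {θₒ : 𝓞 (realField R)}
    (hθ : (θₒ : realField R) = AdjoinRoot.root (realPolyQ R)) (v : HeightOneSpectrum (𝓞 (realField R)))
    (h2 : (2 : 𝓞 (realField R)) ∉ v.asIdeal) (hθv : θₒ ∉ v.asIdeal)
    (hns : ¬ IsSquare (Ideal.Quotient.mk v.asIdeal θₒ)) {q q' : (realField R)ˣ}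
    (hq : Odd (WithZero.log (v.valuation (realField R) (q : realField R))))
    (hq' : ¬ Odd (WithZero.log (v.valuation (realField R) (q' : realField R)))) :
    (QuotientGroup.mk q : cmNormResidueGroup R) ≠ QuotientGroup.mk q' := fun h ↦
  hq' ((odd_log_valuation_iff_of_mk_eq_mk hθ v h2 hθv hns h).1 hq)

/-- **NON-SPLIT by valuation parity, uniformly**: a class `[q]` with `ord_v q` ODD at some place `v ∤ 2θ` of `F`
inert in `E` is NOT the split class `[(-1)^k]` of any `E`-rank `2k` (Deligne Cor. 4.2: the component `W_{2k}.E.[q]`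
has no `E`-Lagrangian member) — the uniform form, for every carrier `R` and every such place at once, of the
prime-by-prime descents of `Ring2WeilCoverageCMFieldInertPrimes` / `…AllPrimes*`.
[cite: Deligne1982HodgeCycles, §4 (1) and Cor. 4.2] [cite: Omeara1963, §63C Example 63:16] -/
theorem mk_ne_splitDiscriminantClassCM_of_odd_log_valuation {θₒ : 𝓞 (realField R)}
    (hθ : (θₒ : realField R) = AdjoinRoot.root (realPolyQ R)) (v : HeightOneSpectrum (𝓞 (realField R)))
    (h2 : (2 : 𝓞 (realField R)) ∉ v.asIdeal) (hθv : θₒ ∉ v.asIdeal)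
    (hns : ¬ IsSquare (Ideal.Quotient.mk v.asIdeal θₒ)) {q : (realField R)ˣ}
    (hq : Odd (WithZero.log (v.valuation (realField R) (q : realField R)))) (k : ℕ) :
    (QuotientGroup.mk q : cmNormResidueGroup R) ≠ splitDiscriminantClassCM R k := by
  rw [splitDiscriminantClassCM]
  refine mk_ne_mk_of_odd_log_valuation hθ v h2 hθv hns hq ?_
  rw [Units.val_pow_eq_pow_val, Units.val_neg, Units.val_one, map_pow, Valuation.map_neg, map_one, one_pow,
    WithZero.log_one]
  decide

/-! ### §9 The integer rows `[ℓw]` at an unramified inert place over `ℓ` -/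

omit [Fact (Irreducible (cmPolyQ R))] in
/-- **`ord_v(ℓ) = 1` at a place `v | ℓ` of `F` unramified over the rational prime `ℓ`** (Mathlib
`intValuation_liesOver`: `ord_v ∘ ι = e · ord_ℓ`). [folklore] -/
theorem log_valuation_natCast_eq_neg_one {ℓ : ℕ} (hℓ : ℓ.Prime) (v : HeightOneSpectrum (𝓞 (realField R)))
    [v.asIdeal.LiesOver (Ideal.span {(ℓ : ℤ)})] (he : (Ideal.span {(ℓ : ℤ)}).ramificationIdx' v.asIdeal = 1) :
    WithZero.log (v.valuation (realField R) (ℓ : realField R)) = -1 := by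
  have hℓ0 : (ℓ : ℤ) ≠ 0 := by exact_mod_cast hℓ.ne_zero
  have hprime : (Ideal.span {(ℓ : ℤ)}).IsPrime :=
    (Ideal.span_singleton_prime hℓ0).2 (Nat.prime_iff_prime_int.1 hℓ)
  let v₀ : HeightOneSpectrum ℤ := ⟨Ideal.span {(ℓ : ℤ)}, hprime, by simpa using hℓ0⟩
  haveI : v.asIdeal.LiesOver v₀.asIdeal := ‹v.asIdeal.LiesOver (Ideal.span {(ℓ : ℤ)})›
  have h := HeightOneSpectrum.intValuation_liesOver v₀ v (ℓ : ℤ)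
  rw [show v₀.asIdeal.ramificationIdx' v.asIdeal = 1 from he, pow_one,
    HeightOneSpectrum.intValuation_singleton (v := v₀) hℓ0 rfl, map_natCast] at h
  have h2 : (ℓ : realField R) = algebraMap (𝓞 (realField R)) (realField R) (ℓ : 𝓞 (realField R)) := by
    rw [map_natCast]
  rw [h2, HeightOneSpectrum.valuation_of_algebraMap, ← h, WithZero.log_exp]

omit [Fact (Irreducible (cmPolyQ R))] in
/-- An integer `w` prime to `ℓ` is a `v`-unit at a place `v | ℓ`: `ord_v w = 0`. [folklore] -/
theorem log_valuation_intCast_eq_zero {ℓ : ℕ} (v : HeightOneSpectrum (𝓞 (realField R)))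
    [v.asIdeal.LiesOver (Ideal.span {(ℓ : ℤ)})] {w : ℤ} (hw : ¬ (ℓ : ℤ) ∣ w) :
    WithZero.log (v.valuation (realField R) (w : realField R)) = 0 := by
  have hw' : (w : 𝓞 (realField R)) ∉ v.asIdeal := by
    intro hmem
    have h1 : (w : ℤ) ∈ v.asIdeal.under ℤ := by
      rw [Ideal.mem_under, eq_intCast]; exact hmem
    rw [← Ideal.over_def v.asIdeal (Ideal.span {(ℓ : ℤ)}), Ideal.mem_span_singleton] at h1
    exact hw h1
  have h2 : (w : realField R) = algebraMap (𝓞 (realField R)) (realField R) (w : 𝓞 (realField R)) := by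
    rw [map_intCast]
  rw [h2, HeightOneSpectrum.valuation_of_algebraMap, HeightOneSpectrum.intValuation_eq_one_iff.2 hw',
    WithZero.log_one]

/-- **THE INTEGER ROWS `[ℓw]` AT AN INERT UNRAMIFIED PLACE, UNIFORMLY**: let `ℓ` be a rational prime and `v | ℓ` a
place of `F` unramified over `ℓ` (`e(v|ℓ) = 1`), prime to `2θ`, at which `θ` is a non-square (INERT in `E`); then
for every integer `w` with `ℓ ∤ w` the class `[ℓw]` is NOT the split class `[(-1)^k]` (`ord_v(ℓw) = 1` is odd) —
the rows `W_{2k}.E.[ℓ]`, `[ℓw]` of §b03.5 at the inert primes, for every carrier `R` (monic) at once.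
[cite: Deligne1982HodgeCycles, §4 (1) and Cor. 4.2] [cite: Omeara1963, §63C Example 63:16] -/
theorem mk_natCast_mul_ne_splitDiscriminantClassCM_of_inert {θₒ : 𝓞 (realField R)}
    (hθ : (θₒ : realField R) = AdjoinRoot.root (realPolyQ R)) {ℓ : ℕ} (hℓ : ℓ.Prime)
    (v : HeightOneSpectrum (𝓞 (realField R))) [v.asIdeal.LiesOver (Ideal.span {(ℓ : ℤ)})]
    (he : (Ideal.span {(ℓ : ℤ)}).ramificationIdx' v.asIdeal = 1)
    (h2 : (2 : 𝓞 (realField R)) ∉ v.asIdeal) (hθv : θₒ ∉ v.asIdeal)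
    (hns : ¬ IsSquare (Ideal.Quotient.mk v.asIdeal θₒ)) {w : ℤ} (hw : ¬ (ℓ : ℤ) ∣ w)
    (q : (realField R)ˣ) (hq : (q : realField R) = (ℓ : realField R) * (w : realField R)) (k : ℕ) :
    (QuotientGroup.mk q : cmNormResidueGroup R) ≠ splitDiscriminantClassCM R k := by
  refine mk_ne_splitDiscriminantClassCM_of_odd_log_valuation hθ v h2 hθv hns ?_ k
  have hℓ0 : v.valuation (realField R) (ℓ : realField R) ≠ 0 :=
    (Valuation.ne_zero_iff _).2 (by exact_mod_cast hℓ.ne_zero)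
  have hw0 : v.valuation (realField R) (w : realField R) ≠ 0 := by
    refine (Valuation.ne_zero_iff _).2 ?_
    have : (w : ℤ) ≠ 0 := fun h ↦ hw (by rw [h]; exact dvd_zero _)
    exact_mod_cast this
  rw [hq, map_mul, WithZero.log_mul hℓ0 hw0, log_valuation_natCast_eq_neg_one hℓ v he,
    log_valuation_intCast_eq_zero v hw]
  decide

end Summit.HodgeConjecture.HodgeConjecture.Ring2.WeilCoverageCM

end
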